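import Summits.CriticalPhenomena.PercolationContinuityZ3.Theorems.PercNearOneGluingNoHeavyLowerTailSunflowerMultiPetalTileG
import HarnessLib
import HarnessLib.Audit

/-!
# `NoHeavyLowerTail` (crux stmt-CriticalPhenomena-4575), abstract sunflower cubic, `k` petals: CONJECTURE G FOR EVERY STRUCTURE ALL OF WHOSE SINGLETONS ARE PETAL OR KERNEL SETS

Support file (seat `prim-l12-p2` gen 33; `--supports stmt-CriticalPhenomena-4575`; companion of `…SunflowerMultiPetalTileG` (this gen: `ZKflip_nonneg_of_modules_cover`) and of
`…SunflowerMultiPetalSingleton` (p343107: the ★ₖ version `ZK_nonneg_of_forall_lab_singleton_ne_zero`)).  Everything here is PROVED; no `sorry`.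
Memo: run/shared/lean/prim/prim-l12/prim-l12-p2/FINDING-g33-MODULE-LIFT.md §1.10.

Every singleton `{e}` is a module (gadget `T ↦ e ∈ T`); if no singleton is a bottom set, the singletons tile the ground type by non-bottom modules, so `…TileG` applies:
* `isModule_singleton` : `IsModule {e} (fun T => decide (e ∈ T))`.
* **`ZKflip_nonneg_of_forall_lab_singleton_ne_zero`**: if `lab {e} ≠ 0` for every `e`, then `0 ≤ ZKflip D` for EVERY flip set `D` — Conjecture G (`FlipPartitionLemmaK`) for every
  structure whose bottom family is `{∅}` (every coordinate a petal or kernel singleton), for every `k`; `D = ∅` is p343107.  In particular G for the `m`-atom structures `θ_m`.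
-/

namespace Summit.CriticalPhenomena.PercolationContinuityZ3.Theorems.SunflowerPartition

open Finset

variable {α : Type*} [DecidableEq α]

namespace MSunflower

variable {k : ℕ} (F : MSunflower k α)

/-- Every singleton is a module, with gadget `T ↦ e ∈ T`. [this work] -/
theorem isModule_singleton (e : α) : F.IsModule {e} (fun T => decide (e ∈ T)) := by
  intro X
  congr 1
  by_cases he : e ∈ X
  · rw [inter_singleton_of_mem he]
    simp only [mem_singleton_self, decide_true, if_true]
    exact (sdiff_union_of_subset (singleton_subset_iff.2 he)).symm
  · rw [inter_singleton_of_notMem he]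
    simp only [Finset.notMem_empty, decide_false, Bool.false_eq_true, if_false, union_empty]
    rw [sdiff_singleton_eq_erase, erase_eq_of_notMem he]

/-- **CONJECTURE G WHEN EVERY SINGLETON IS A PETAL OR KERNEL SET**: `lab {e} ≠ 0` for all `e` implies `0 ≤ ZKflip D` for every flip set `D`. [this work] -/
theorem ZKflip_nonneg_of_forall_lab_singleton_ne_zero [Fintype α] (h : ∀ e : α, F.lab {e} ≠ 0) (D : Finset α) : 0 ≤ F.ZKflip D := by
  refine F.ZKflip_nonneg_of_modules_cover (univ : Finset α) (fun e => ({e} : Finset α)) (fun e => fun T => decide (e ∈ T))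
    (fun e _ => F.isModule_singleton e) (fun e _ => h e) (fun i _ j _ hij => disjoint_singleton.2 hij) ?_ D
  exact Finset.biUnion_singleton_eq_self

end MSunflower

end Summit.CriticalPhenomena.PercolationContinuityZ3.Theorems.SunflowerPartition
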